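import Summits.QuantumFields.YangMills.Theorems.BalabanUVNodesN19TVCurrency
import Mathlib.MeasureTheory.Measure.Prod
import Mathlib.MeasureTheory.Measure.WithDensity

/-!
# BalabanUVNodes ∕ N19 — THE CLASS-LEVEL CURRENCIES OVER INDEPENDENT BLOCKS, ONE CLASS: TV radii of PRODUCT laws compose like bad weights,
# `1 − (1 − ρ₁)(1 − ρ₂)`, SHARP; masses multiply; measure sandwiches (SHAPE) compose `(c₁ + c₂, r₁ + r₂)`

Cell `pub-ymgap` (HUMAN RULING D-0062 Track A ∕ D-0149 width seats), WIDTH SEAT `pub-ymgap-dag-n19-w2` (node n19 = NE7, seat 2 of 3), generation g4,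
CLAIM-1 ∕ INTENT-1 (INBOX l.28752).  Route `Summits/QuantumFields/YangMills/Theses/BalabanUVNodes.lean`, key item K3⁷ `SpineGivenEndpointR13SepCoPH`
(stmt-QuantumFields-20544); filed `--kind proof --supports … --as helper`.  COUNT-NEUTRAL.  THEOREMS ONLY (0 `def`, 0 `sorry`); imports dag-n19-c's
`…Theorems.BalabanUVNodesN19TVCurrency` (`abs_integral_sub_integral_le_of_tv`, the layer-cake TV-integral bound, CONSUMED BY NAME) and Mathlib's product measure
(`Measure.prod_apply`, `prod_prod`, `prod_mono`, `prod_smul_left∕right`); edits nothing, re-declares nothing.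

WHY.  dag-n19-c (`…N19CoreTVInvariant`, p504410): the observable-uniform invariant behind the NE7-proper leaf `Spine.NE7.Core` on common class spaces is EXACTLY
MASS_cl ∧ TV_cl, SHAPE_cl being strictly more.  This seat's g2 (`…N19CoreProductBlocks` p593172 ∕ `…Family` p594080) composed node U5's shapes over INDEPENDENT BLOCKS at
the TERM level (`core_prod` multiplies the blocks' class terms — exactly the observables that FACTOR over the blocks).  This file is the one-class half of the
class-level companion: the three currencies MASS ∕ TV ∕ SHAPE of two runs' class pieces under the product of two independent blocks `X × Y`, so that file 2
(`…N19CoreTVInvariantBlocks`) lets blockwise matching data carry EVERY bounded JOINT observable on the product class space — the ones `core_prod` cannot see.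

WHAT IS PROVED ([folklore]; «TV» = closeness of two (normalised) laws on every measurable SET, reference-measure-free, as n19-c spells it).
* §0 (reals) the product radius `ρ₁ + ρ₂ − ρ₁ρ₂ = 1 − (1 − ρ₁)(1 − ρ₂)` — the SAME law as g2's bad-weight composition `W₁ + W₂ − W₁W₂` (`relWeightBound_prod`).
* §1 sections: `measurable_sectionReal` · ★ `prod_real_eq_integral_sectionReal` (`(μ ⊗ ν)(S) = ∫ ν(S_x) dμ(x)` in REAL letters) · `abs_sectionReal_sub_le_of_tv` ·
  `abs_real_sub_real_le_one` (a TV radius may always be capped at `1`).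
* §2 ★★ `prod_real_sub_prod_real_le_of_tv` ∕ ★★ `abs_prod_real_sub_prod_real_le_of_tv`: probability laws `p, p′` on `X` `ρ₁`-close on every set, `q, q′` on `Y` `ρ₂`-close
  (`0 ≤ ρ₂ ≤ 1`) ⇒ the PRODUCT laws are `(ρ₁ + ρ₂ − ρ₁ρ₂)`-close on every measurable `S ⊆ X × Y`.  Mechanism (no coupling, no Hahn set): sections `f = q(S_·)`,
  `f′ = q′(S_·) ∈ [0, 1]`, `|f′ − f| ≤ ρ₂`; the CAPPED majorant `g = min(f + ρ₂, 1) ∈ [ρ₂, 1]` dominates `f′`, so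
  `∫ f′ dp′ ≤ ∫ g dp′ ≤ ∫ g dp + (1 − ρ₂)ρ₁ ≤ ∫ f dp + ρ₂ + (1 − ρ₂)ρ₁` (n19-c's bound on the range `[ρ₂, 1]` — the cap is where the cross term `−ρ₁ρ₂` comes from);
  exchange the runs for the other side.  `abs_prod_real_sub_prod_real_le_add_of_tv`: the plain sub-additive `ρ₁ + ρ₂`, NO range condition.
* §3 class pieces (finite measures, n19-c's normalised TV_cl letters `|μ′(S)∕μ′(univ) − μ(S)∕μ(univ)| ≤ ρ`, massless pieces reading `0`):
  ★★ `abs_prod_div_sub_prod_div_le_of_tv` (blockwise TV_cl(ρ_b), `ρ_b ∈ [0, 1]` ⇒ TV_cl(ρ₁ + ρ₂ − ρ₁ρ₂) for the product pieces; a block massless in exactly one run forces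
  that block's radius to `1`, where the product radius reads `1`) with its dictionary `normalized_real` · `normalized_prod_normalized` · `prod_div_eq_normalized_prod_real`.
* §4 MASS `massSandwich_prod`: masses MULTIPLY, the `ℝ≥0∞` mass sandwiches compose `(c₁ + c₂, r₁ + r₂)`.  §5 SHAPE `shapeSandwich_prod`: measure sandwiches compose
  `(c₁ + c₂, r₁ + r₂)` (supports multiply: the SHAPE road still refuses blockwise support mismatch — n19-c `tv_not_shape_toy` per block — the TV road tolerates it).
* SHARPNESS is file 2's §1 (`…N19CoreTVInvariantBlocks.tv_prod_sharp_toy`): on `Bool × Bool` the two-point blocks attain `ρ₁ + ρ₂ − ρ₁ρ₂` EXACTLY — TV radii of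
  independent blocks are NOT additive-and-sharp; they compose exactly like bad weights, and no constant below §2's is a theorem.
NEAREST ART, CITED NOT RESTATED: Mathlib (pinned toolchain) has the product measure and `SignedMeasure.totalVariation` but no TV distance of probability laws and no
product bound for it; n19-c `tvSandwich_map` (push-forward, same `ρ`) is the unary companion; g2 `core_prod` ∕ `relWeightBound_prod` the term-level companions.

HONEST FRAMING.  [folklore] measure theory on hypothesis SHAPES produced by nobody (TV_cl ∕ MASS_cl ∕ SHAPE_cl of two runs' class pieces); ZERO Bałaban content —
[Balaban1988Convergent] (2.18)'s history weights do NOT factor over blocks (the polymer coupling across blocks IS NE7's content); this only says what INDEPENDENTLY matched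
blocks would buy.  NE7 ∕ NE1′ NOT PRINTED as two-run statements for d = 4 and NOT proved; N14 ∕ N19 NOT discharged; K3⁷ OPEN, not claimed; counts UNMOVED (typed 28∕28 ·
discharged 5∕27 · A 5∕28); no count claim.  One finite four-torus programme at fixed `ε`; R4 closes the conditional finite-𝕋⁴ rung `BalabanLadder.UV` only — NOT ℝ⁴, NOT OS,
NOT the Yang–Mills mass gap, NOT Clay.  0 `def`; 0 `sorry`; standard axioms.
-/

set_option autoImplicit false

noncomputable section

open MeasureTheory ProbabilityTheory
open scoped ENNReal

namespace Summit.QuantumFields.YangMills.BalabanUVNodes.N19TVProductBlocks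

open Summit.QuantumFields.YangMills.BalabanUVNodes.N19TVCurrency (abs_integral_sub_integral_le_of_tv)

/-! ## §0 The product radius `ρ₁ + ρ₂ − ρ₁ρ₂ = 1 − (1 − ρ₁)(1 − ρ₂)` [folklore] -/

section Radius

/-- The product radius is the bad-weight law: `ρ₁ + ρ₂ − ρ₁ρ₂ = 1 − (1 − ρ₁)(1 − ρ₂)`. [folklore] -/
theorem prodRadius_eq (ρ₁ ρ₂ : ℝ) : ρ₁ + ρ₂ - ρ₁ * ρ₂ = 1 - (1 - ρ₁) * (1 - ρ₂) := by ring

/-- The product radius is nonnegative once one radius is nonnegative and the other lies in `[0, 1]`. [folklore] -/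
theorem prodRadius_nonneg {ρ₁ ρ₂ : ℝ} (h₁ : 0 ≤ ρ₁) (h₂ : 0 ≤ ρ₂) (h₂' : ρ₂ ≤ 1) : 0 ≤ ρ₁ + ρ₂ - ρ₁ * ρ₂ := by
  nlinarith [mul_nonneg h₁ (sub_nonneg.2 h₂')]

/-- The product radius of radii `≤ 1` is `≤ 1`. [folklore] -/
theorem prodRadius_le_one {ρ₁ ρ₂ : ℝ} (h₁ : ρ₁ ≤ 1) (h₂ : ρ₂ ≤ 1) : ρ₁ + ρ₂ - ρ₁ * ρ₂ ≤ 1 := by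
  nlinarith [mul_nonneg (sub_nonneg.2 h₁) (sub_nonneg.2 h₂)]

/-- Each block's radius survives in the product radius (left block). [folklore] -/
theorem le_prodRadius_left {ρ₁ ρ₂ : ℝ} (h₁ : ρ₁ ≤ 1) (h₂ : 0 ≤ ρ₂) : ρ₁ ≤ ρ₁ + ρ₂ - ρ₁ * ρ₂ := by
  nlinarith [mul_nonneg (sub_nonneg.2 h₁) h₂]

/-- The product radius is monotone in each block's radius (within `[·, 1]`). [folklore] -/
theorem prodRadius_mono {ρ₁ ρ₁' ρ₂ ρ₂' : ℝ} (h₁ : ρ₁ ≤ ρ₁') (h₂ : ρ₂ ≤ ρ₂') (hρ₁' : ρ₁' ≤ 1) (hρ₂ : ρ₂ ≤ 1) :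
    ρ₁ + ρ₂ - ρ₁ * ρ₂ ≤ ρ₁' + ρ₂' - ρ₁' * ρ₂' := by
  nlinarith [mul_nonneg (sub_nonneg.2 h₁) (sub_nonneg.2 hρ₂), mul_nonneg (sub_nonneg.2 h₂) (sub_nonneg.2 hρ₁')]

/-- At `ρ₁ = 1` (one block's laws may be mutually singular) the product radius is `1` whatever the other block does. [folklore] -/
theorem prodRadius_one_left (ρ₂ : ℝ) : 1 + ρ₂ - 1 * ρ₂ = 1 := by ring

/-- At `ρ₂ = 1` the product radius is `1`. [folklore] -/
theorem prodRadius_one_right (ρ₁ : ℝ) : ρ₁ + 1 - ρ₁ * 1 = 1 := by ring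

end Radius

/-! ## §1 Sections of a product law, in real letters [folklore] -/

section Sections

variable {X Y : Type*} [MeasurableSpace X] [MeasurableSpace Y]

/-- The section function `x ↦ ν(S_x)` of a measurable `S ⊆ X × Y` is measurable (real letters). [folklore] -/
theorem measurable_sectionReal (ν : Measure Y) [SFinite ν] {S : Set (X × Y)} (hS : MeasurableSet S) :
    Measurable fun x => ν.real (Prod.mk x ⁻¹' S) :=
  (measurable_measure_prodMk_left hS).ennreal_toReal

/-- ★ **THE PRODUCT LAW OF A SET IS THE INTEGRAL OF ITS SECTIONS, IN REAL LETTERS**: `(μ ⊗ ν)(S) = ∫ ν(S_x) dμ(x)` for `ν` finite (Mathlib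
`Measure.prod_apply`, `integral_toReal`). [folklore] -/
theorem prod_real_eq_integral_sectionReal (μ : Measure X) (ν : Measure Y) [IsFiniteMeasure ν] {S : Set (X × Y)}
    (hS : MeasurableSet S) : (μ.prod ν).real S = ∫ x, ν.real (Prod.mk x ⁻¹' S) ∂μ := by
  simp only [measureReal_def]
  rw [Measure.prod_apply hS,
    integral_toReal (measurable_measure_prodMk_left hS).aemeasurable (ae_of_all _ fun x => measure_lt_top ν _)]

/-- TV-closeness of two laws on `Y` is inherited by every section of a measurable `S ⊆ X × Y`. [folklore] -/
theorem abs_sectionReal_sub_le_of_tv {q q' : Measure Y} {ρ : ℝ} (h : ∀ S : Set Y, MeasurableSet S → |q'.real S - q.real S| ≤ ρ)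
    {S : Set (X × Y)} (hS : MeasurableSet S) (x : X) :
    |q'.real (Prod.mk x ⁻¹' S) - q.real (Prod.mk x ⁻¹' S)| ≤ ρ :=
  h _ (hS.preimage measurable_prodMk_left)

/-- Two probability laws are `1`-close on every set for free (so a TV radius may always be capped at `1`). [folklore] -/
theorem abs_real_sub_real_le_one (p p' : Measure X) [IsProbabilityMeasure p] [IsProbabilityMeasure p'] (S : Set X) :
    |p'.real S - p.real S| ≤ 1 := by
  rw [abs_le]
  constructor
  · linarith [measureReal_nonneg (μ := p') (s := S), measureReal_le_one (μ := p) (s := S)]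
  · linarith [measureReal_nonneg (μ := p) (s := S), measureReal_le_one (μ := p') (s := S)]

/-- A TV hypothesis forces its radius to be nonnegative (test the empty set). [folklore] -/
theorem radius_nonneg_of_tv {p p' : Measure X} {ρ : ℝ} (h : ∀ S : Set X, MeasurableSet S → |p'.real S - p.real S| ≤ ρ) : 0 ≤ ρ :=
  (abs_nonneg _).trans (h ∅ MeasurableSet.empty)

/-- A measurable function with values in `[0, 1]` is integrable against a finite measure. [folklore] -/
theorem integrable_of_unit_range (μ : Measure X) [IsFiniteMeasure μ] {u : X → ℝ} (hu : Measurable u) (h0 : ∀ x, 0 ≤ u x)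
    (h1 : ∀ x, u x ≤ 1) : Integrable u μ :=
  (integrable_const (1 : ℝ)).mono' hu.aestronglyMeasurable
    (ae_of_all _ fun x => by rw [Real.norm_eq_abs, abs_of_nonneg (h0 x)]; exact h1 x)

end Sections

/-! ## §2 TV radii of product laws: `1 − (1 − ρ₁)(1 − ρ₂)` [folklore] -/

section ProductTV

variable {X Y : Type*} [MeasurableSpace X] [MeasurableSpace Y]
  {p p' : Measure X} {q q' : Measure Y} [IsProbabilityMeasure p] [IsProbabilityMeasure p'] [IsProbabilityMeasure q]
  [IsProbabilityMeasure q'] {ρ₁ ρ₂ : ℝ}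

/-- ★★ **ONE-SIDED PRODUCT BOUND.**  Probability laws `p, p′` on `X` `ρ₁`-close on every set, `q, q′` on `Y` `ρ₂`-close on every set with `0 ≤ ρ₂ ≤ 1`:
`(p′ ⊗ q′)(S) − (p ⊗ q)(S) ≤ ρ₁ + ρ₂ − ρ₁ρ₂` on every measurable `S ⊆ X × Y`.  Sections `f = q(S_·)`, `f′ = q′(S_·)`, capped majorant `g = min(f + ρ₂, 1) ∈ [ρ₂, 1]`:
`∫ f′ dp′ ≤ ∫ g dp′ ≤ ∫ g dp + (1 − ρ₂)ρ₁ ≤ ∫ f dp + ρ₂ + (1 − ρ₂)ρ₁`. [folklore] -/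
theorem prod_real_sub_prod_real_le_of_tv (hρ₂ : 0 ≤ ρ₂) (hρ₂1 : ρ₂ ≤ 1)
    (h₁ : ∀ S : Set X, MeasurableSet S → |p'.real S - p.real S| ≤ ρ₁)
    (h₂ : ∀ S : Set Y, MeasurableSet S → |q'.real S - q.real S| ≤ ρ₂) {S : Set (X × Y)} (hS : MeasurableSet S) :
    (p'.prod q').real S - (p.prod q).real S ≤ ρ₁ + ρ₂ - ρ₁ * ρ₂ := by
  set f : X → ℝ := fun x => q.real (Prod.mk x ⁻¹' S) with hf
  set f' : X → ℝ := fun x => q'.real (Prod.mk x ⁻¹' S) with hf'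
  set g : X → ℝ := fun x => min (f x + ρ₂) 1 with hg
  have hfm : Measurable f := measurable_sectionReal q hS
  have hf'm : Measurable f' := measurable_sectionReal q' hS
  have hgm : Measurable g := (hfm.add_const ρ₂).min measurable_const
  have hf0 : ∀ x, 0 ≤ f x := fun x => measureReal_nonneg
  have hf1 : ∀ x, f x ≤ 1 := fun x => measureReal_le_one
  have hf'0 : ∀ x, 0 ≤ f' x := fun x => measureReal_nonneg
  have hf'1 : ∀ x, f' x ≤ 1 := fun x => measureReal_le_one
  have hf'g : ∀ x, f' x ≤ g x := fun x =>
    le_min (by have h := (abs_le.1 (abs_sectionReal_sub_le_of_tv h₂ hS x)).2; linarith) (hf'1 x)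
  have hglo : ∀ x, ρ₂ ≤ g x := fun x => le_min (by linarith [hf0 x]) hρ₂1
  have hg0 : ∀ x, 0 ≤ g x := fun x => hρ₂.trans (hglo x)
  have hghi : ∀ x, g x ≤ 1 := fun x => min_le_right _ _
  have hgf : ∀ x, g x ≤ f x + ρ₂ := fun x => min_le_left _ _
  rw [prod_real_eq_integral_sectionReal p' q' hS, prod_real_eq_integral_sectionReal p q hS]
  have step1 : ∫ x, f' x ∂p' ≤ ∫ x, g x ∂p' :=
    integral_mono (integrable_of_unit_range p' hf'm hf'0 hf'1) (integrable_of_unit_range p' hgm hg0 hghi) hf'g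
  have step2 : |∫ x, g x ∂p' - ∫ x, g x ∂p| ≤ (1 - ρ₂) * ρ₁ := abs_integral_sub_integral_le_of_tv hgm hglo hghi hρ₂1 h₁
  have step3 : ∫ x, g x ∂p ≤ ∫ x, f x ∂p + ρ₂ := by
    calc ∫ x, g x ∂p ≤ ∫ x, (f x + ρ₂) ∂p :=
          integral_mono (integrable_of_unit_range p hgm hg0 hghi) ((integrable_of_unit_range p hfm hf0 hf1).add (integrable_const _)) hgf
      _ = ∫ x, f x ∂p + ρ₂ := by
          rw [integral_add (integrable_of_unit_range p hfm hf0 hf1) (integrable_const _), integral_const, smul_eq_mul,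
            probReal_univ, one_mul]
  have step2' := (abs_le.1 step2).2
  have hring : (1 - ρ₂) * ρ₁ + ρ₂ = ρ₁ + ρ₂ - ρ₁ * ρ₂ := by ring
  linarith

/-- ★★ **TV RADII OF INDEPENDENT BLOCKS COMPOSE LIKE BAD WEIGHTS.**  Probability laws `p, p′` on `X` `ρ₁`-close on every set and `q, q′` on `Y` `ρ₂`-close on every
set, `0 ≤ ρ₂ ≤ 1` (a TV radius may always be capped at `1`, `abs_real_sub_real_le_one`): the PRODUCT laws are `(ρ₁ + ρ₂ − ρ₁ρ₂) = 1 − (1 − ρ₁)(1 − ρ₂)`-close on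
every measurable `S ⊆ X × Y`.  SHARP (file 2 `…N19CoreTVInvariantBlocks.tv_prod_sharp_toy`).  Reference-measure-free; no coupling. [folklore] -/
theorem abs_prod_real_sub_prod_real_le_of_tv (hρ₂ : 0 ≤ ρ₂) (hρ₂1 : ρ₂ ≤ 1)
    (h₁ : ∀ S : Set X, MeasurableSet S → |p'.real S - p.real S| ≤ ρ₁)
    (h₂ : ∀ S : Set Y, MeasurableSet S → |q'.real S - q.real S| ≤ ρ₂) {S : Set (X × Y)} (hS : MeasurableSet S) :
    |(p'.prod q').real S - (p.prod q).real S| ≤ ρ₁ + ρ₂ - ρ₁ * ρ₂ := by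
  have h₁' : ∀ S : Set X, MeasurableSet S → |p.real S - p'.real S| ≤ ρ₁ := fun S hS => by
    rw [abs_sub_comm]; exact h₁ S hS
  have h₂' : ∀ S : Set Y, MeasurableSet S → |q.real S - q'.real S| ≤ ρ₂ := fun S hS => by
    rw [abs_sub_comm]; exact h₂ S hS
  exact abs_sub_le_iff.2
    ⟨prod_real_sub_prod_real_le_of_tv hρ₂ hρ₂1 h₁ h₂ hS, prod_real_sub_prod_real_le_of_tv hρ₂ hρ₂1 h₁' h₂' hS⟩

/-- **THE SUB-ADDITIVE BOUND, NO RANGE CONDITION**: blockwise TV radii `ρ₁`, `ρ₂` ⇒ the product laws are `(ρ₁ + ρ₂)`-close on every set (cap `ρ₂` at `1` by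
`abs_real_sub_real_le_one`, apply the sharp bound, drop the cross term). [folklore] -/
theorem abs_prod_real_sub_prod_real_le_add_of_tv (h₁ : ∀ S : Set X, MeasurableSet S → |p'.real S - p.real S| ≤ ρ₁)
    (h₂ : ∀ S : Set Y, MeasurableSet S → |q'.real S - q.real S| ≤ ρ₂) {S : Set (X × Y)} (hS : MeasurableSet S) :
    |(p'.prod q').real S - (p.prod q).real S| ≤ ρ₁ + ρ₂ := by
  have hρ₁ : 0 ≤ ρ₁ := radius_nonneg_of_tv h₁
  have hm0 : 0 ≤ min ρ₂ 1 := le_min (radius_nonneg_of_tv h₂) zero_le_one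
  have h₂c : ∀ S : Set Y, MeasurableSet S → |q'.real S - q.real S| ≤ min ρ₂ 1 := fun S hS =>
    le_min (h₂ S hS) (abs_real_sub_real_le_one q q' S)
  calc |(p'.prod q').real S - (p.prod q).real S| ≤ ρ₁ + min ρ₂ 1 - ρ₁ * min ρ₂ 1 :=
        abs_prod_real_sub_prod_real_le_of_tv hm0 (min_le_right _ _) h₁ h₂c hS
    _ ≤ ρ₁ + ρ₂ := by nlinarith [min_le_left ρ₂ 1, mul_nonneg hρ₁ hm0]

end ProductTV

/-! ## §3 Class pieces: finite measures, normalised (n19-c's TV_cl letters) [folklore] -/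

section ClassPieces

variable {X Y : Type*} [MeasurableSpace X] [MeasurableSpace Y]

/-- The normalised law of a finite measure with nonzero mass is a probability law. [folklore] -/
theorem isProbabilityMeasure_normalized {μ : Measure X} [IsFiniteMeasure μ] (h0 : μ Set.univ ≠ 0) :
    IsProbabilityMeasure ((μ Set.univ)⁻¹ • μ) :=
  ⟨by rw [Measure.smul_apply, smul_eq_mul, ENNReal.inv_mul_cancel h0 (measure_ne_top _ _)]⟩

/-- The normalised law reads `μ(S)∕μ(univ)` on every set (real letters). [folklore] -/
theorem normalized_real (μ : Measure X) [IsFiniteMeasure μ] (S : Set X) :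
    ((μ Set.univ)⁻¹ • μ).real S = μ.real S / μ.real Set.univ := by
  rw [measureReal_ennreal_smul_apply, ENNReal.toReal_inv, ← measureReal_def, div_eq_inv_mul]

/-- The quotient `μ(S)∕μ(univ)` lies in `[0, 1]` (massless pieces read `0`). [folklore] -/
theorem div_univ_mem_unit (μ : Measure X) [IsFiniteMeasure μ] (S : Set X) :
    0 ≤ μ.real S / μ.real Set.univ ∧ μ.real S / μ.real Set.univ ≤ 1 :=
  ⟨div_nonneg measureReal_nonneg measureReal_nonneg,
    div_le_one_of_le₀ (measureReal_mono (Set.subset_univ S)) measureReal_nonneg⟩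

/-- A massless piece reads `0` on every set in the normalised letters. [folklore] -/
theorem div_univ_eq_zero_of_mass (μ : Measure X) [IsFiniteMeasure μ] (h0 : μ Set.univ = 0) (S : Set X) :
    μ.real S / μ.real Set.univ = 0 := by
  rw [measureReal_def μ Set.univ, h0, ENNReal.toReal_zero, div_zero]

/-- If one run's piece is massless and the other's is not, their TV radius in the normalised letters is `≥ 1` (test `S = univ`). [folklore] -/
theorem one_le_radius_of_mass_zero {μ μ' : Measure X} [IsFiniteMeasure μ] [IsFiniteMeasure μ'] {ρ : ℝ} (h0 : μ Set.univ = 0)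
    (h0' : μ' Set.univ ≠ 0)
    (h : ∀ S : Set X, MeasurableSet S → |μ'.real S / μ'.real Set.univ - μ.real S / μ.real Set.univ| ≤ ρ) : 1 ≤ ρ := by
  have key := h Set.univ MeasurableSet.univ
  have hm' : μ'.real Set.univ ≠ 0 := (measureReal_ne_zero_iff (measure_ne_top _ _)).2 h0'
  rwa [div_univ_eq_zero_of_mass μ h0, div_self hm', sub_zero, abs_one] at key

/-- The same with the roles exchanged. [folklore] -/
theorem one_le_radius_of_mass_zero' {μ μ' : Measure X} [IsFiniteMeasure μ] [IsFiniteMeasure μ'] {ρ : ℝ} (h0 : μ Set.univ ≠ 0)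
    (h0' : μ' Set.univ = 0)
    (h : ∀ S : Set X, MeasurableSet S → |μ'.real S / μ'.real Set.univ - μ.real S / μ.real Set.univ| ≤ ρ) : 1 ≤ ρ :=
  one_le_radius_of_mass_zero h0' h0 fun S hS => by rw [abs_sub_comm]; exact h S hS

/-- The mass of a product piece is the product of the masses. [folklore] -/
theorem prod_univ (μ : Measure X) (ν : Measure Y) [SFinite ν] : (μ.prod ν) Set.univ = μ Set.univ * ν Set.univ := by
  rw [← Set.univ_prod_univ, Measure.prod_prod]

/-- A product piece is massless iff one factor is. [folklore] -/
theorem prod_univ_eq_zero_iff (μ : Measure X) (ν : Measure Y) [SFinite ν] :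
    (μ.prod ν) Set.univ = 0 ↔ μ Set.univ = 0 ∨ ν Set.univ = 0 := by
  rw [prod_univ, mul_eq_zero]

/-- The product of the normalised laws IS the normalised product law (masses nonzero). [folklore] -/
theorem normalized_prod_normalized (μ : Measure X) (ν : Measure Y) [IsFiniteMeasure μ] [IsFiniteMeasure ν] :
    ((μ Set.univ)⁻¹ • μ).prod ((ν Set.univ)⁻¹ • ν) = ((μ.prod ν) Set.univ)⁻¹ • μ.prod ν := by
  rw [Measure.prod_smul_left, Measure.prod_smul_right, smul_smul, prod_univ,
    ENNReal.mul_inv (Or.inr (measure_ne_top _ _)) (Or.inl (measure_ne_top _ _))]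

/-- The normalised letters of a product piece ARE the real letters of the product of the normalised laws. [folklore] -/
theorem prod_div_eq_normalized_prod_real (μ : Measure X) (ν : Measure Y) [IsFiniteMeasure μ] [IsFiniteMeasure ν] (S : Set (X × Y)) :
    (μ.prod ν).real S / (μ.prod ν).real Set.univ = (((μ Set.univ)⁻¹ • μ).prod ((ν Set.univ)⁻¹ • ν)).real S := by
  rw [normalized_prod_normalized, normalized_real]

/-- The massless half of `abs_prod_div_sub_prod_div_le_of_tv`: if run A's product piece is massless, the gap is at most the product radius (either both product
pieces are massless, or the responsible block's radius is `1`). [folklore] -/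
theorem abs_prod_div_sub_zero_le_of_tv {μ₁ μ₁' : Measure X} {μ₂ μ₂' : Measure Y} [IsFiniteMeasure μ₁] [IsFiniteMeasure μ₁']
    [IsFiniteMeasure μ₂] [IsFiniteMeasure μ₂'] {ρ₁ ρ₂ : ℝ} (hρ₁ : 0 ≤ ρ₁) (hρ₁1 : ρ₁ ≤ 1) (hρ₂ : 0 ≤ ρ₂) (hρ₂1 : ρ₂ ≤ 1)
    (h₁ : ∀ S : Set X, MeasurableSet S → |μ₁'.real S / μ₁'.real Set.univ - μ₁.real S / μ₁.real Set.univ| ≤ ρ₁)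
    (h₂ : ∀ S : Set Y, MeasurableSet S → |μ₂'.real S / μ₂'.real Set.univ - μ₂.real S / μ₂.real Set.univ| ≤ ρ₂)
    (hA : (μ₁.prod μ₂) Set.univ = 0) (S : Set (X × Y)) :
    |(μ₁'.prod μ₂').real S / (μ₁'.prod μ₂').real Set.univ - (μ₁.prod μ₂).real S / (μ₁.prod μ₂).real Set.univ| ≤
      ρ₁ + ρ₂ - ρ₁ * ρ₂ := by
  have hunit' := div_univ_mem_unit (μ₁'.prod μ₂') S
  rw [div_univ_eq_zero_of_mass _ hA, sub_zero, abs_of_nonneg hunit'.1]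
  by_cases hB : (μ₁'.prod μ₂') Set.univ = 0
  · rw [div_univ_eq_zero_of_mass _ hB]; exact prodRadius_nonneg hρ₁ hρ₂ hρ₂1
  · obtain ⟨hB₁, hB₂⟩ := not_or.1 (mt (prod_univ_eq_zero_iff μ₁' μ₂').2 hB)
    refine hunit'.2.trans ?_
    rcases (prod_univ_eq_zero_iff μ₁ μ₂).1 hA with h0 | h0
    · rw [le_antisymm hρ₁1 (one_le_radius_of_mass_zero h0 hB₁ h₁), prodRadius_one_left]
    · rw [le_antisymm hρ₂1 (one_le_radius_of_mass_zero h0 hB₂ h₂), prodRadius_one_right]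

/-- ★★ **TV_cl OF PRODUCT CLASS PIECES.**  Two runs' class pieces `μ₁, μ₁′` on `X` and `μ₂, μ₂′` on `Y` (finite measures), blockwise TV_cl in n19-c's normalised letters
with radii `ρ₁, ρ₂ ∈ [0, 1]`: the product pieces `μ₁ ⊗ μ₂`, `μ₁′ ⊗ μ₂′` satisfy TV_cl with radius `ρ₁ + ρ₂ − ρ₁ρ₂`.  Massless corner cases: a block massless in exactly one run
forces that block's radius to be `1` (`one_le_radius_of_mass_zero`), where the product radius reads `1`; otherwise normalise and apply §2. [folklore] -/
theorem abs_prod_div_sub_prod_div_le_of_tv {μ₁ μ₁' : Measure X} {μ₂ μ₂' : Measure Y} [IsFiniteMeasure μ₁] [IsFiniteMeasure μ₁']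
    [IsFiniteMeasure μ₂] [IsFiniteMeasure μ₂'] {ρ₁ ρ₂ : ℝ} (hρ₁ : 0 ≤ ρ₁) (hρ₁1 : ρ₁ ≤ 1) (hρ₂ : 0 ≤ ρ₂) (hρ₂1 : ρ₂ ≤ 1)
    (h₁ : ∀ S : Set X, MeasurableSet S → |μ₁'.real S / μ₁'.real Set.univ - μ₁.real S / μ₁.real Set.univ| ≤ ρ₁)
    (h₂ : ∀ S : Set Y, MeasurableSet S → |μ₂'.real S / μ₂'.real Set.univ - μ₂.real S / μ₂.real Set.univ| ≤ ρ₂)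
    {S : Set (X × Y)} (hS : MeasurableSet S) :
    |(μ₁'.prod μ₂').real S / (μ₁'.prod μ₂').real Set.univ - (μ₁.prod μ₂).real S / (μ₁.prod μ₂).real Set.univ| ≤
      ρ₁ + ρ₂ - ρ₁ * ρ₂ := by
  by_cases hA : (μ₁.prod μ₂) Set.univ = 0
  · exact abs_prod_div_sub_zero_le_of_tv hρ₁ hρ₁1 hρ₂ hρ₂1 h₁ h₂ hA S
  by_cases hB : (μ₁'.prod μ₂') Set.univ = 0
  · rw [abs_sub_comm]
    exact abs_prod_div_sub_zero_le_of_tv hρ₁ hρ₁1 hρ₂ hρ₂1 (fun S hS => by rw [abs_sub_comm]; exact h₁ S hS)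
      (fun S hS => by rw [abs_sub_comm]; exact h₂ S hS) hB S
  -- all four masses nonzero: normalise and apply §2
  obtain ⟨hA₁, hA₂⟩ := not_or.1 (mt (prod_univ_eq_zero_iff μ₁ μ₂).2 hA)
  obtain ⟨hB₁, hB₂⟩ := not_or.1 (mt (prod_univ_eq_zero_iff μ₁' μ₂').2 hB)
  haveI := isProbabilityMeasure_normalized hA₁; haveI := isProbabilityMeasure_normalized hA₂
  haveI := isProbabilityMeasure_normalized hB₁; haveI := isProbabilityMeasure_normalized hB₂
  have h₁' : ∀ S : Set X, MeasurableSet S → |((μ₁' Set.univ)⁻¹ • μ₁').real S - ((μ₁ Set.univ)⁻¹ • μ₁).real S| ≤ ρ₁ :=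
    fun S hS => by rw [normalized_real, normalized_real]; exact h₁ S hS
  have h₂' : ∀ S : Set Y, MeasurableSet S → |((μ₂' Set.univ)⁻¹ • μ₂').real S - ((μ₂ Set.univ)⁻¹ • μ₂).real S| ≤ ρ₂ :=
    fun S hS => by rw [normalized_real, normalized_real]; exact h₂ S hS
  rw [prod_div_eq_normalized_prod_real, prod_div_eq_normalized_prod_real]
  exact abs_prod_real_sub_prod_real_le_of_tv hρ₂ hρ₂1 h₁' h₂' hS

end ClassPieces

/-! ## §4 MASS: masses multiply, mass sandwiches compose `(c₁ + c₂, r₁ + r₂)` [folklore] -/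

section Mass

variable {X Y : Type*} [MeasurableSpace X] [MeasurableSpace Y]

/-- **MASS SANDWICHES COMPOSE OVER BLOCKS**: blockwise `e^{c_b − r_b}·mA_b ≤ mB_b ≤ e^{c_b + r_b}·mA_b` (n19-c's `ℝ≥0∞` MASS_cl letters) ⇒ the product pieces' masses are
sandwiched with `(c₁ + c₂, r₁ + r₂)` — masses multiply (`prod_univ`). [folklore] -/
theorem massSandwich_prod {μA₁ μB₁ : Measure X} {μA₂ μB₂ : Measure Y} [SFinite μA₂] [SFinite μB₂] {c₁ r₁ c₂ r₂ : ℝ}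
    (h₁ : ENNReal.ofReal (Real.exp (c₁ - r₁)) * μA₁ Set.univ ≤ μB₁ Set.univ ∧
      μB₁ Set.univ ≤ ENNReal.ofReal (Real.exp (c₁ + r₁)) * μA₁ Set.univ)
    (h₂ : ENNReal.ofReal (Real.exp (c₂ - r₂)) * μA₂ Set.univ ≤ μB₂ Set.univ ∧
      μB₂ Set.univ ≤ ENNReal.ofReal (Real.exp (c₂ + r₂)) * μA₂ Set.univ) :
    ENNReal.ofReal (Real.exp ((c₁ + c₂) - (r₁ + r₂))) * (μA₁.prod μA₂) Set.univ ≤ (μB₁.prod μB₂) Set.univ ∧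
      (μB₁.prod μB₂) Set.univ ≤ ENNReal.ofReal (Real.exp ((c₁ + c₂) + (r₁ + r₂))) * (μA₁.prod μA₂) Set.univ := by
  -- `e^{a}·e^{b} = e^{a+b}` in `ℝ≥0∞` letters (dag-n14-w3's `YMDAG.N14.ShapeFace.ofReal_exp_mul_ofReal_exp`, inlined to keep the imports lean)
  have e : ∀ a b : ℝ, ENNReal.ofReal (Real.exp a) * ENNReal.ofReal (Real.exp b) = ENNReal.ofReal (Real.exp (a + b)) := fun a b => by
    rw [← ENNReal.ofReal_mul (Real.exp_pos a).le, ← Real.exp_add]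
  rw [prod_univ, prod_univ, show (c₁ + c₂) - (r₁ + r₂) = (c₁ - r₁) + (c₂ - r₂) by ring,
    show (c₁ + c₂) + (r₁ + r₂) = (c₁ + r₁) + (c₂ + r₂) by ring, ← e, ← e, mul_mul_mul_comm,
    mul_mul_mul_comm (ENNReal.ofReal _) (ENNReal.ofReal _)]
  exact ⟨mul_le_mul' h₁.1 h₂.1, mul_le_mul' h₁.2 h₂.2⟩

end Mass

/-! ## §5 SHAPE: measure sandwiches compose `(c₁ + c₂, r₁ + r₂)` [folklore] -/

section Shape

variable {X Y : Type*} [MeasurableSpace X] [MeasurableSpace Y]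

/-- **MEASURE SANDWICHES (SHAPE_cl ∕ NE7-S_cl letters) COMPOSE OVER BLOCKS**: blockwise `e^{c_b − r_b}•μA_b ≤ μB_b ≤ e^{c_b + r_b}•μA_b` ⇒
`e^{(c₁+c₂) − (r₁+r₂)}•(μA₁ ⊗ μA₂) ≤ μB₁ ⊗ μB₂ ≤ e^{(c₁+c₂) + (r₁+r₂)}•(μA₁ ⊗ μA₂)` (`Measure.prod_mono`; supports multiply). [folklore] -/
theorem shapeSandwich_prod {μA₁ μB₁ : Measure X} {μA₂ μB₂ : Measure Y} [SFinite μA₂] [SFinite μB₂] {c₁ r₁ c₂ r₂ : ℝ}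
    (h₁ : ENNReal.ofReal (Real.exp (c₁ - r₁)) • μA₁ ≤ μB₁ ∧ μB₁ ≤ ENNReal.ofReal (Real.exp (c₁ + r₁)) • μA₁)
    (h₂ : ENNReal.ofReal (Real.exp (c₂ - r₂)) • μA₂ ≤ μB₂ ∧ μB₂ ≤ ENNReal.ofReal (Real.exp (c₂ + r₂)) • μA₂) :
    ENNReal.ofReal (Real.exp ((c₁ + c₂) - (r₁ + r₂))) • μA₁.prod μA₂ ≤ μB₁.prod μB₂ ∧
      μB₁.prod μB₂ ≤ ENNReal.ofReal (Real.exp ((c₁ + c₂) + (r₁ + r₂))) • μA₁.prod μA₂ := by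
  have e : ∀ a b : ℝ, ENNReal.ofReal (Real.exp a) * ENNReal.ofReal (Real.exp b) = ENNReal.ofReal (Real.exp (a + b)) := fun a b => by
    rw [← ENNReal.ofReal_mul (Real.exp_pos a).le, ← Real.exp_add]
  have lo := Measure.prod_mono h₁.1 h₂.1
  have hi := Measure.prod_mono h₁.2 h₂.2
  rw [Measure.prod_smul_left, Measure.prod_smul_right, smul_smul, e] at lo hi
  rw [show (c₁ + c₂) - (r₁ + r₂) = (c₁ - r₁) + (c₂ - r₂) by ring, show (c₁ + c₂) + (r₁ + r₂) = (c₁ + r₁) + (c₂ + r₂) by ring]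
  exact ⟨lo, hi⟩

end Shape

end Summit.QuantumFields.YangMills.BalabanUVNodes.N19TVProductBlocks

end
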